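import Mathlib.Analysis.Complex.Circle
import Mathlib.Analysis.SpecialFunctions.Complex.Log
import Mathlib.GroupTheory.OrderOfElement
import Mathlib.Data.Int.GCD
import HarnessLib

/-!
# The angular part `z ↦ z/‖z‖ : ℂˣ → S¹`; unitary characters of `ℝˣ` trivial on `ℝ_{>0}`

Topic `Analysis/Complex`; namespace `Literature.Analysis.Complex`. Mathlib-only, everything proved,
no instances.

* `unitPart : ℂˣ →* Circle`, `z ↦ z / ‖z‖` (`coe_unitPart`, `continuous_unitPart`,
  `unitPart_apply_of_norm_eq_one`); `exists_norm_eq_one_zpow_ne_one`: for `d ≠ 0` a unit complex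
  number `ζ` with `ζ ^ d ≠ 1`;
* `ofRealUnits : ℝˣ →* ℂˣ`; on `ℝˣ` the angular part is the sign: `unitPart_ofRealUnits_of_pos`,
  `coe_unitPart_ofRealUnits_of_neg`, `unitPart_ofRealUnits_sq` (`(x/|x|)² = 1`), hence
  `unitPart_ofRealUnits_zpow_congr(_iff)`: `(x/|x|)^{a} = (x/|x|)^{b}` on `ℝˣ` iff `a ≡ b (mod 2)`;
* `exists_normSq_eq_iff`: `N_{ℂ/ℝ}(ℂˣ) = ℝ_{>0}`;
* **`eq_unitPart_of_trivial_on_pos`**: a character `χ : ℝˣ →* S¹` trivial on `ℝ_{>0}` is trivial or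
  `x ↦ x/|x|` (`…_of_ne_one`: the nontrivial one is the sign).

(The local dictionary at a real place for unitary Hecke characters: the ∞-type character
`(z/|z|)^m` restricted to `ℝˣ ⊂ ℂˣ`, and the character of `ℝˣ` trivial on the norms from `ℂˣ`;
A. Weil, *Basic Number Theory*, Ch. XIII §§1–2 [WeilBNT1967].)

## Provenance

Reproduced for the tree under the LEAN-IN-TREE rule (2026-08-18) from the pub-hodgecm cell's
package files `HodgeCM/PerL34/InfinityType.lean` §1 and `HodgeCM/PerL34/RealPlaceSigns.lean`
(DAG-node prover #10 lineage, seat pv10, gate run 22), verbatim up to the namespace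
(`Complex.X` ↦ `Literature.Analysis.Complex.X`) and added docstring tags.
-/

set_option autoImplicit false

noncomputable section

namespace Literature.Analysis.Complex

/-! ## The angular part -/

/-- The angular part `z ↦ z / ‖z‖ : ℂˣ → S¹`. [folklore] -/
def unitPart : ℂˣ →* Circle where
  toFun z := ⟨(z : ℂ) / ‖(z : ℂ)‖, mem_sphere_zero_iff_norm.2 <| by
    rw [norm_div, Complex.norm_real, norm_norm, div_self (norm_ne_zero_iff.mpr z.ne_zero)]⟩
  map_one' := Subtype.ext <| by simp
  map_mul' x y := Subtype.ext <| by
    simp only [Units.val_mul, norm_mul, Complex.ofReal_mul]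
    show (x : ℂ) * y / (‖(x : ℂ)‖ * ‖(y : ℂ)‖ : ℂ) = (x : ℂ) / ‖(x : ℂ)‖ * ((y : ℂ) / ‖(y : ℂ)‖)
    rw [div_mul_div_comm]

/-- `unitPart z = z / ‖z‖` in `ℂ`. [folklore] -/
@[simp] theorem coe_unitPart (z : ℂˣ) : (unitPart z : ℂ) = (z : ℂ) / ‖(z : ℂ)‖ := rfl

/-- The angular part is continuous. [folklore] -/
theorem continuous_unitPart : Continuous unitPart := by
  have h : Continuous fun z : ℂˣ => (z : ℂ) / (‖(z : ℂ)‖ : ℂ) :=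
    Units.continuous_val.div (Complex.continuous_ofReal.comp (continuous_norm.comp
      Units.continuous_val)) fun z => by exact_mod_cast norm_ne_zero_iff.mpr z.ne_zero
  exact Continuous.subtype_mk h _

/-- On norm-one elements the angular part is the identity. [folklore] -/
theorem unitPart_apply_of_norm_eq_one (z : ℂˣ) (hz : ‖(z : ℂ)‖ = 1) :
    (unitPart z : ℂ) = z := by
  simp [hz]

/-- A unit complex number `ζ` with `ζ ^ d ≠ 1`, for `d ≠ 0` (`ζ = exp (π i / d)`). [folklore] -/
theorem exists_norm_eq_one_zpow_ne_one {d : ℤ} (hd : d ≠ 0) :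
    ∃ ζ : ℂ, ‖ζ‖ = 1 ∧ ζ ^ d ≠ 1 := by
  refine ⟨Complex.exp ((Real.pi / d : ℝ) * Complex.I), Complex.norm_exp_ofReal_mul_I _, ?_⟩
  rw [← Complex.exp_int_mul]
  have : (d : ℂ) * (((Real.pi / d : ℝ) : ℂ) * Complex.I) = Real.pi * Complex.I := by
    have hd' : (d : ℂ) ≠ 0 := by exact_mod_cast hd
    push_cast
    field_simp
  rw [this, Complex.exp_pi_mul_I]
  norm_num

/-! ## The angular part on `ℝˣ`: signs -/

/-- In a group, an element of square `1` has equal powers at exponents congruent mod `2`.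
[folklore] -/
theorem zpow_eq_zpow_of_sq_eq_one_of_modEq {G : Type*} [Group G] {g : G} (hg : g ^ 2 = 1)
    {a b : ℤ} (h : a ≡ b [ZMOD 2]) : g ^ a = g ^ b := by
  obtain ⟨k, hk⟩ := (Int.ModEq.dvd h : (2 : ℤ) ∣ b - a)
  have hb : b = a + 2 * k := by omega
  have h2 : g ^ (2 : ℤ) = 1 := by rw [zpow_two, ← pow_two, hg]
  rw [hb, zpow_add, zpow_mul, h2, one_zpow, mul_one]

/-- `ℝˣ → ℂˣ`. [folklore] -/
def ofRealUnits : ℝˣ →* ℂˣ := Units.map (Complex.ofRealHom : ℝ →+* ℂ).toMonoidHom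

/-- `ofRealUnits x = x` in `ℂ`. [folklore] -/
@[simp] theorem coe_ofRealUnits (x : ℝˣ) : ((ofRealUnits x : ℂˣ) : ℂ) = ((x : ℝ) : ℂ) := rfl

/-- `unitPart x = x/|x|` for real `x`. [folklore] -/
theorem coe_unitPart_ofRealUnits (x : ℝˣ) :
    (unitPart (ofRealUnits x) : ℂ) = (((x : ℝ) / |(x : ℝ)| : ℝ) : ℂ) := by
  rw [coe_unitPart, coe_ofRealUnits, Complex.norm_real, Real.norm_eq_abs, Complex.ofReal_div]

/-- `x/|x| = 1` for `x > 0`. [folklore] -/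
theorem unitPart_ofRealUnits_of_pos (x : ℝˣ) (hx : 0 < (x : ℝ)) :
    unitPart (ofRealUnits x) = 1 := by
  apply Circle.ext
  rw [coe_unitPart_ofRealUnits, abs_of_pos hx, div_self x.ne_zero, Complex.ofReal_one,
    Circle.coe_one]

/-- `x/|x| = -1` for `x < 0`. [folklore] -/
theorem coe_unitPart_ofRealUnits_of_neg (x : ℝˣ) (hx : (x : ℝ) < 0) :
    (unitPart (ofRealUnits x) : ℂ) = -1 := by
  rw [coe_unitPart_ofRealUnits, abs_of_neg hx, div_neg, div_self x.ne_zero, Complex.ofReal_neg,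
    Complex.ofReal_one]

/-- `(x/|x|)² = 1` on `ℝˣ`. [folklore] -/
theorem unitPart_ofRealUnits_sq (x : ℝˣ) : unitPart (ofRealUnits x) ^ 2 = 1 := by
  apply Circle.ext
  rw [Circle.coe_pow, Circle.coe_one]
  rcases lt_or_gt_of_ne x.ne_zero with h | h
  · rw [coe_unitPart_ofRealUnits_of_neg x h]; norm_num
  · rw [unitPart_ofRealUnits_of_pos x h, Circle.coe_one, one_pow]

/-- On `ℝˣ ⊂ ℂˣ` the characters `(z/|z|)^{m_b}` and `(x/|x|)^m` coincide as soon as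
`m_b ≡ m (mod 2)`. [folklore] -/
theorem unitPart_ofRealUnits_zpow_congr (x : ℝˣ) {mb m : ℤ} (h : mb ≡ m [ZMOD 2]) :
    unitPart (ofRealUnits x) ^ mb = unitPart (ofRealUnits x) ^ m :=
  zpow_eq_zpow_of_sq_eq_one_of_modEq (unitPart_ofRealUnits_sq x) h

/-- … and ONLY then (test at `x = -1`). [folklore] -/
theorem unitPart_ofRealUnits_zpow_congr_iff {mb m : ℤ} :
    (∀ x : ℝˣ, unitPart (ofRealUnits x) ^ mb = unitPart (ofRealUnits x) ^ m) ↔ mb ≡ m [ZMOD 2] := by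
  refine ⟨fun h => ?_, fun h x => unitPart_ofRealUnits_zpow_congr x h⟩
  -- `u := (-1)/|-1| = -1` has order `2` in `Circle`, and `u ^ mb = u ^ m`
  have hneg : (((-1 : ℝˣ) : ℝ)) < 0 := by rw [Units.val_neg, Units.val_one]; norm_num
  have hu1 : unitPart (ofRealUnits (-1)) ≠ 1 := by
    intro h1
    have := congrArg (fun z : Circle => (z : ℂ)) h1
    simp only [coe_unitPart_ofRealUnits_of_neg (-1) hneg, Circle.coe_one] at this
    norm_num at this
  have hord : orderOf (unitPart (ofRealUnits (-1))) = 2 :=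
    orderOf_eq_prime (unitPart_ofRealUnits_sq (-1)) hu1
  have := (zpow_eq_zpow_iff_modEq (x := unitPart (ofRealUnits (-1)))).mp (h (-1))
  rwa [hord] at this

/-- **`N_{ℂ/ℝ}(ℂˣ) = ℝ_{>0}`.**  A real number is the norm `z \bar z` of a nonzero complex number
iff it is positive. [folklore] -/
theorem exists_normSq_eq_iff (x : ℝ) : (∃ z : ℂ, z ≠ 0 ∧ Complex.normSq z = x) ↔ 0 < x := by
  constructor
  · rintro ⟨z, hz, rfl⟩
    exact Complex.normSq_pos.mpr hz
  · intro hx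
    refine ⟨(Real.sqrt x : ℂ), ?_, ?_⟩
    · exact_mod_cast (Real.sqrt_pos.mpr hx).ne'
    · rw [Complex.normSq_ofReal, Real.mul_self_sqrt hx.le]

/-- **A unitary character of `ℝˣ` trivial on `ℝ_{>0}` is either trivial or `x ↦ x/|x|`.** (At a
real place under a complex one, the local component of the quadratic character of the quadratic
extension is the NONTRIVIAL such character.) [cite: WeilBNT1967, Ch. XIII §1] -/
theorem eq_unitPart_of_trivial_on_pos (χ : ℝˣ →* Circle)
    (hpos : ∀ x : ℝˣ, 0 < (x : ℝ) → χ x = 1) :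
    χ = 1 ∨ χ = unitPart.comp ofRealUnits := by
  have key : ∀ x : ℝˣ, (x : ℝ) < 0 → χ x = χ (-1) := by
    intro x hx
    have hnx : 0 < ((-x : ℝˣ) : ℝ) := by rw [Units.val_neg]; exact neg_pos.mpr hx
    calc χ x = χ (-1 * -x) := by rw [neg_one_mul, neg_neg]
      _ = χ (-1) := by rw [map_mul, hpos (-x) hnx, mul_one]
  have hsq : (χ (-1) : ℂ) * χ (-1) = 1 := by
    rw [← Circle.coe_mul, ← map_mul, neg_one_mul, neg_neg, map_one, Circle.coe_one]
  rcases mul_self_eq_one_iff.mp hsq with h1 | h1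
  · left
    refine MonoidHom.ext fun x => ?_
    rcases lt_or_gt_of_ne x.ne_zero with hx | hx
    · rw [key x hx, MonoidHom.one_apply]
      exact Circle.ext (by rw [h1, Circle.coe_one])
    · rw [hpos x hx, MonoidHom.one_apply]
  · right
    refine MonoidHom.ext fun x => ?_
    rw [MonoidHom.comp_apply]
    rcases lt_or_gt_of_ne x.ne_zero with hx | hx
    · exact Circle.ext (by rw [key x hx, h1, coe_unitPart_ofRealUnits_of_neg x hx])
    · rw [hpos x hx, unitPart_ofRealUnits_of_pos x hx]

/-- The nontrivial branch: a NONTRIVIAL character of `ℝˣ` trivial on `ℝ_{>0}` is `x/|x|`.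
[folklore] -/
theorem eq_unitPart_of_trivial_on_pos_of_ne_one (χ : ℝˣ →* Circle)
    (hpos : ∀ x : ℝˣ, 0 < (x : ℝ) → χ x = 1) (hne : χ ≠ 1) :
    χ = unitPart.comp ofRealUnits :=
  (eq_unitPart_of_trivial_on_pos χ hpos).resolve_left hne

end Literature.Analysis.Complex

end
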